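import Mathlib
import HarnessLib
import Summits.PneNP.PneNP.Theses.CnfIdealGenLength
import Summits.PneNP.PneNP.Theorems.CnfIdealGenLengthRankCount
import Literature.Computability.AlgebraicComplexity.HessianRank
import Literature.Computability.Complexity.ArthurMerlinKarpClosure

/-!
# Route `CnfIdealGenLength` — polynomial rank-stability refutes `RankDefectRepresentations`

The route's kill criterion for the support item `RankDefectRepresentations` (stmt-PneNP-18923), made
kernel-checked: a witness of the item must be FAR from every genuine representation.

* `eval_clauseProduct_eq_zero_of_commute`: under pairwise COMMUTING IDEMPOTENT matrices `M'` the clause product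
  of an unsatisfiable CNF evaluates to `0` (the point indicators `∏_{i∈t} M'_i ∏_{i∉t} (1 - M'_i)` sum to `1` and
  each is killed by the factor of a clause it... satisfies — commutative algebra in `Algebra.adjoin K (range M')`);
* `rank_eval_clauseProduct_sub_le`: `rank (P_φ(M) - P_φ(M')) ≤ Σ_{literal occurrences (i,b) of φ} rank (M_i - M'_i)`
  (telescoping);
* hence `rank P_φ(M) ≤ size φ · max_i rank (M_i - M'_i)` for every commuting idempotent tuple `M'`, and
  `not_rankDefectRepresentations_of_polyStable`: if the Boolean/commutator presentation is POLYNOMIALLY rank-stable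
  (every tuple with axiom ranks `≤ t` is within rank `n^a · t`, coordinatewise, of a commuting idempotent tuple,
  eventually in `n`) then `¬ RankDefectRepresentations`. (Known: stability with modulus `2^{O(n)} · t`; whether a
  polynomial modulus holds is open — this is the "ST-poly" alternative of the item's why-it-might-fail.)
-/

set_option linter.dupNamespace false -- `Summit.PneNP.PneNP.…`: summit = sub-problem name (D-0017)

namespace Summit.PneNP.PneNP.Theorems.CnfIdealGenLength

open Filter
open Literature.Computability.Complexity
open Literature.Computability.MetaComplexity
open Literature.Computability.MetaComplexity.NCIPS

section Commutative

variable {S : Type*} [CommRing S] {n : ℕ}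

/-- Point indicator of a set `t` of "true" coordinates for a family of commuting elements `e`:
`(∏_{i ∈ t} e_i) · ∏_{i ∉ t} (1 - e_i)` (local notation-free helper, stated through its value). [folklore] -/
theorem sum_pointIndicator_eq_one (e : Fin n → S) :
    ∑ t : Finset (Fin n), (∏ i ∈ t, e i) * ∏ i ∈ tᶜ, (1 - e i) = 1 := by
  have h := Finset.prod_add (fun i => e i) (fun i => 1 - e i) (Finset.univ : Finset (Fin n))
  simp only [add_sub_cancel, Finset.prod_const_one, Finset.powerset_univ] at h
  calc ∑ t : Finset (Fin n), (∏ i ∈ t, e i) * ∏ i ∈ tᶜ, (1 - e i)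
      = ∑ t : Finset (Fin n), (∏ i ∈ t, e i) * ∏ i ∈ Finset.univ \ t, (1 - e i) :=
        Finset.sum_congr rfl fun t _ => by rw [Finset.compl_eq_univ_sdiff]
    _ = 1 := h.symm

/-- A point indicator times a literal factor: `0` if the literal is true at the point, the indicator
itself if it is false (idempotency `e_i² = e_i`). [folklore] -/
theorem pointIndicator_mul_lit (e : Fin n → S) (he : ∀ i, e i * e i = e i) (t : Finset (Fin n))
    (l : Literal (Fin n)) :
    ((∏ i ∈ t, e i) * ∏ i ∈ tᶜ, (1 - e i)) * (if l.2 then 1 - e l.1 else e l.1) =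
      if Literal.eval (fun i => decide (i ∈ t)) l then 0 else (∏ i ∈ t, e i) * ∏ i ∈ tᶜ, (1 - e i) := by
  rcases l with ⟨j, b⟩
  have he' : (1 - e j) * (1 - e j) = 1 - e j := by linear_combination he j
  by_cases hj : j ∈ t
  · have hsplit := Finset.mul_prod_erase t e hj
    -- with `j ∈ t`: the factor `e_j` is absorbed, the factor `1 - e_j` kills
    have k1 : ((∏ i ∈ t, e i) * ∏ i ∈ tᶜ, (1 - e i)) * e j = (∏ i ∈ t, e i) * ∏ i ∈ tᶜ, (1 - e i) := by
      rw [← hsplit]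
      calc e j * (∏ x ∈ t.erase j, e x) * (∏ i ∈ tᶜ, (1 - e i)) * e j
          = (e j * e j) * (∏ x ∈ t.erase j, e x) * ∏ i ∈ tᶜ, (1 - e i) := by ring
        _ = _ := by rw [he]
    have k2 : ((∏ i ∈ t, e i) * ∏ i ∈ tᶜ, (1 - e i)) * (1 - e j) = 0 := by
      rw [← hsplit]
      calc e j * (∏ x ∈ t.erase j, e x) * (∏ i ∈ tᶜ, (1 - e i)) * (1 - e j)
          = (e j - e j * e j) * ((∏ x ∈ t.erase j, e x) * ∏ i ∈ tᶜ, (1 - e i)) := by ring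
        _ = 0 := by rw [he, sub_self, zero_mul]
    cases b
    · simpa [Literal.eval, hj] using k1
    · simpa [Literal.eval, hj] using k2
  · have hj' : j ∈ tᶜ := Finset.mem_compl.2 hj
    have hsplit := Finset.mul_prod_erase tᶜ (fun i => 1 - e i) hj'
    -- with `j ∉ t`: the factor `1 - e_j` is absorbed, the factor `e_j` kills
    have k1 : ((∏ i ∈ t, e i) * ∏ i ∈ tᶜ, (1 - e i)) * e j = 0 := by
      rw [← hsplit]
      calc (∏ i ∈ t, e i) * ((1 - e j) * ∏ x ∈ tᶜ.erase j, (1 - e x)) * e j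
          = (e j - e j * e j) * ((∏ i ∈ t, e i) * ∏ x ∈ tᶜ.erase j, (1 - e x)) := by ring
        _ = 0 := by rw [he, sub_self, zero_mul]
    have k2 : ((∏ i ∈ t, e i) * ∏ i ∈ tᶜ, (1 - e i)) * (1 - e j) =
        (∏ i ∈ t, e i) * ∏ i ∈ tᶜ, (1 - e i) := by
      rw [← hsplit]
      calc (∏ i ∈ t, e i) * ((1 - e j) * ∏ x ∈ tᶜ.erase j, (1 - e x)) * (1 - e j)
          = ((1 - e j) * (1 - e j)) * ((∏ i ∈ t, e i) * ∏ x ∈ tᶜ.erase j, (1 - e x)) := by ring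
        _ = _ := by rw [he']; ring
    cases b
    · simpa [Literal.eval, hj] using k1
    · simpa [Literal.eval, hj] using k2

/-- A point indicator times a clause word: the indicator if the clause is false at the point, else `0`.
[folklore] -/
theorem pointIndicator_mul_clause (e : Fin n → S) (he : ∀ i, e i * e i = e i) (t : Finset (Fin n))
    (κ : Clause (Fin n)) :
    ((∏ i ∈ t, e i) * ∏ i ∈ tᶜ, (1 - e i)) * (κ.map fun l => if l.2 then 1 - e l.1 else e l.1).prod =
      if Clause.eval (fun i => decide (i ∈ t)) κ then 0 else (∏ i ∈ t, e i) * ∏ i ∈ tᶜ, (1 - e i) := by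
  induction κ with
  | nil => simp [Clause.eval]
  | cons l κ ih =>
    have hc : Clause.eval (fun i => decide (i ∈ t)) (l :: κ) =
        (Literal.eval (fun i => decide (i ∈ t)) l || Clause.eval (fun i => decide (i ∈ t)) κ) := rfl
    rw [List.map_cons, List.prod_cons, ← mul_assoc, pointIndicator_mul_lit e he, hc]
    cases Literal.eval (fun i => decide (i ∈ t)) l
    · simpa using ih
    · simp

/-- A point indicator times the clause product: the indicator if the CNF is true at the point, else `0`.
[folklore] -/
theorem pointIndicator_mul_cnf (e : Fin n → S) (he : ∀ i, e i * e i = e i) (t : Finset (Fin n))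
    (φ : CNF (Fin n)) :
    ((∏ i ∈ t, e i) * ∏ i ∈ tᶜ, (1 - e i)) *
        (φ.map fun κ => 1 - (κ.map fun l => if l.2 then 1 - e l.1 else e l.1).prod).prod =
      if φ.eval (fun i => decide (i ∈ t)) then (∏ i ∈ t, e i) * ∏ i ∈ tᶜ, (1 - e i) else 0 := by
  induction φ with
  | nil => simp
  | cons κ φ ih =>
    rw [List.map_cons, List.prod_cons, ← mul_assoc, mul_sub, mul_one, pointIndicator_mul_clause e he,
      CNF.eval_cons]
    cases Clause.eval (fun i => decide (i ∈ t)) κ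
    · simp
    · simpa using ih

/-- In a commutative ring, idempotents `e_i` never model an unsatisfiable CNF: its clause product
`∏_κ (1 - ∏_{l∈κ} lit_l)` vanishes. [folklore] -/
theorem cnfProduct_eq_zero_of_idempotent (e : Fin n → S) (he : ∀ i, e i * e i = e i) {φ : CNF (Fin n)}
    (hφ : ¬ φ.Satisfiable) :
    (φ.map fun κ => 1 - (κ.map fun l => if l.2 then 1 - e l.1 else e l.1).prod).prod = 0 := by
  set P := (φ.map fun κ => 1 - (κ.map fun l => if l.2 then 1 - e l.1 else e l.1).prod).prod with hP
  have h1 := sum_pointIndicator_eq_one e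
  calc P = (∑ t : Finset (Fin n), (∏ i ∈ t, e i) * ∏ i ∈ tᶜ, (1 - e i)) * P := by rw [h1, one_mul]
    _ = ∑ t : Finset (Fin n), ((∏ i ∈ t, e i) * ∏ i ∈ tᶜ, (1 - e i)) * P := Finset.sum_mul _ _ _
    _ = 0 := Finset.sum_eq_zero fun t _ => ?_
  rw [hP, pointIndicator_mul_cnf e he]
  have : φ.eval (fun i => decide (i ∈ t)) = false := by
    cases h : φ.eval (fun i => decide (i ∈ t))
    · rfl
    · exact absurd ⟨_, h⟩ hφ
  simp [this]

end Commutative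

section Matrices

variable {K : Type*} [Field K] {d n : ℕ}

/-- **No rank at genuine representations.** Pairwise commuting idempotent matrices send the clause product of
an unsatisfiable CNF to `0`. [folklore] -/
theorem eval_clauseProduct_eq_zero_of_commute (M : Fin n → Matrix (Fin d) (Fin d) K)
    (hidem : ∀ i, M i * M i = M i) (hcomm : ∀ i j, M i * M j = M j * M i) {φ : CNF (Fin n)}
    (hφ : ¬ φ.Satisfiable) :
    MonoidAlgebra.lift K (Matrix (Fin d) (Fin d) K) (FreeMonoid (Fin n)) (FreeMonoid.lift M)
      (clauseProduct K φ) = 0 := by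
  have hc : IsMulCommutative (Algebra.adjoin K (Set.range M)) :=
    Algebra.isMulCommutative_adjoin K (by rintro _ ⟨i, rfl⟩ _ ⟨j, rfl⟩; exact hcomm i j)
  letI : CommRing (Algebra.adjoin K (Set.range M)) :=
    { (inferInstance : Ring (Algebra.adjoin K (Set.range M))) with mul_comm := hc.is_comm.comm }
  set e : Fin n → Algebra.adjoin K (Set.range M) :=
    fun i => ⟨M i, Algebra.subset_adjoin (Set.mem_range_self i)⟩ with he_def
  have he : ∀ i, e i * e i = e i := fun i => Subtype.ext (hidem i)
  have h0 := cnfProduct_eq_zero_of_idempotent e he hφ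
  have hval := congrArg (Algebra.adjoin K (Set.range M)).val h0
  rw [map_zero] at hval
  rw [lift_clauseProduct, ← hval, map_list_prod, List.map_map]
  congr 1
  refine List.map_congr_left fun κ _ => ?_
  simp only [Function.comp_apply, map_sub, map_one, map_list_prod, List.map_map]
  congr 2
  refine List.map_congr_left fun l _ => ?_
  simp only [Function.comp_apply, FreeMonoid.lift_eval_of]
  split_ifs <;> simp [he_def]

/-- Rank is invariant under negation. [folklore] -/
theorem rank_neg_eq {m : Type*} [Fintype m] [DecidableEq m] (A : Matrix m m K) : (-A).rank = A.rank := by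
  apply le_antisymm
  · simpa using Matrix.rank_mul_le_right (-1 : Matrix m m K) A
  · simpa using Matrix.rank_mul_le_right (-1 : Matrix m m K) (-A)

/-- Telescoping for the clause word: `rank (Q_κ(M) - Q_κ(M')) ≤ Σ_{l∈κ} rank (M_{l} - M'_{l})`. [folklore] -/
theorem rank_clauseWordEval_sub_le (M M' : Fin n → Matrix (Fin d) (Fin d) K) (κ : Clause (Fin n)) :
    ((κ.map fun l => if l.2 then 1 - M l.1 else M l.1).prod -
        (κ.map fun l => if l.2 then 1 - M' l.1 else M' l.1).prod).rank ≤
      (κ.map fun l => (M l.1 - M' l.1).rank).sum := by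
  induction κ with
  | nil => simp
  | cons l κ ih =>
    simp only [List.map_cons, List.prod_cons, List.sum_cons]
    set A := (if l.2 then 1 - M l.1 else M l.1) with hA
    set A' := (if l.2 then 1 - M' l.1 else M' l.1) with hA'
    set B := (κ.map fun l => if l.2 then 1 - M l.1 else M l.1).prod
    set B' := (κ.map fun l => if l.2 then 1 - M' l.1 else M' l.1).prod
    have hsplit : A * B - A' * B' = A * (B - B') + (A - A') * B' := by noncomm_ring
    have hAA' : (A - A').rank = (M l.1 - M' l.1).rank := by
      rw [hA, hA']
      split_ifs
      · rw [show (1 - M l.1) - (1 - M' l.1) = -(M l.1 - M' l.1) by abel, rank_neg_eq]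
      · rfl
    rw [hsplit]
    refine (Literature.Computability.AlgebraicComplexity.rank_add_le _ _).trans ?_
    rw [add_comm]
    exact Nat.add_le_add ((Matrix.rank_mul_le_left _ _).trans hAA'.le)
      ((Matrix.rank_mul_le_right _ _).trans ih)

/-- **Telescoping for the clause product:** `rank (P_φ(M) - P_φ(M')) ≤ Σ_{κ∈φ} Σ_{l∈κ} rank (M_l - M'_l)`.
[folklore] -/
theorem rank_eval_clauseProduct_sub_le (M M' : Fin n → Matrix (Fin d) (Fin d) K) (φ : CNF (Fin n)) :
    (MonoidAlgebra.lift K (Matrix (Fin d) (Fin d) K) (FreeMonoid (Fin n)) (FreeMonoid.lift M)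
          (clauseProduct K φ) -
        MonoidAlgebra.lift K (Matrix (Fin d) (Fin d) K) (FreeMonoid (Fin n)) (FreeMonoid.lift M')
          (clauseProduct K φ)).rank ≤
      (φ.map fun κ => (κ.map fun l => (M l.1 - M' l.1).rank).sum).sum := by
  rw [lift_clauseProduct, lift_clauseProduct]
  simp only [FreeMonoid.lift_eval_of]
  induction φ with
  | nil => simp
  | cons κ φ ih =>
    simp only [List.map_cons, List.prod_cons, List.sum_cons]
    set A := 1 - (κ.map fun l => if l.2 then 1 - M l.1 else M l.1).prod with hA
    set A' := 1 - (κ.map fun l => if l.2 then 1 - M' l.1 else M' l.1).prod with hA'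
    set B := (φ.map fun κ => 1 - (κ.map fun l => if l.2 then 1 - M l.1 else M l.1).prod).prod
    set B' := (φ.map fun κ => 1 - (κ.map fun l => if l.2 then 1 - M' l.1 else M' l.1).prod).prod
    have hsplit : A * B - A' * B' = A * (B - B') + (A - A') * B' := by noncomm_ring
    have hAA' : (A - A').rank ≤ (κ.map fun l => (M l.1 - M' l.1).rank).sum := by
      have h := rank_clauseWordEval_sub_le M M' κ
      rw [← rank_neg_eq] at h
      have hE : A - A' = -((κ.map fun l => if l.2 then 1 - M l.1 else M l.1).prod -
          (κ.map fun l => if l.2 then 1 - M' l.1 else M' l.1).prod) := by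
        simp only [hA, hA']; abel
      rwa [hE]
    rw [hsplit]
    refine (Literature.Computability.AlgebraicComplexity.rank_add_le _ _).trans ?_
    rw [add_comm]
    exact Nat.add_le_add ((Matrix.rank_mul_le_left _ _).trans hAA') ((Matrix.rank_mul_le_right _ _).trans ih)

/-- Bookkeeping: the occurrence sum of coordinate ranks is at most `size φ` times a uniform bound. [folklore] -/
theorem sum_rank_le_size_mul (M M' : Fin n → Matrix (Fin d) (Fin d) K) {D : ℕ} (hD : ∀ i, (M i - M' i).rank ≤ D)
    (φ : CNF (Fin n)) :
    (φ.map fun κ => (κ.map fun l => (M l.1 - M' l.1).rank).sum).sum ≤ φ.size * D := by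
  unfold CNF.size
  induction φ with
  | nil => simp
  | cons κ φ ih =>
    simp only [List.map_cons, List.sum_cons, Nat.add_mul]
    refine Nat.add_le_add ?_ ih
    induction κ with
    | nil => simp
    | cons l κ ihκ =>
      simp only [List.map_cons, List.sum_cons, List.length_cons, Nat.succ_mul]
      have := hD l.1
      omega

/-- **Rank at a near-representation.** For every commuting idempotent tuple `M'` and unsatisfiable `φ`:
`rank P_φ(M) ≤ size φ · max_i rank (M_i - M'_i)` (here with a uniform bound `D` on the coordinate ranks).
[folklore] -/
theorem rank_eval_clauseProduct_le_size_mul (M M' : Fin n → Matrix (Fin d) (Fin d) K)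
    (hidem : ∀ i, M' i * M' i = M' i) (hcomm : ∀ i j, M' i * M' j = M' j * M' i) {φ : CNF (Fin n)}
    (hφ : ¬ φ.Satisfiable) {D : ℕ} (hD : ∀ i, (M i - M' i).rank ≤ D) :
    (MonoidAlgebra.lift K (Matrix (Fin d) (Fin d) K) (FreeMonoid (Fin n)) (FreeMonoid.lift M)
      (clauseProduct K φ)).rank ≤ φ.size * D := by
  have h := rank_eval_clauseProduct_sub_le M M' φ
  rw [eval_clauseProduct_eq_zero_of_commute M' hidem hcomm hφ, sub_zero] at h
  exact h.trans (sum_rank_le_size_mul M M' hD φ)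

end Matrices

/-- **Polynomial rank-stability refutes `RankDefectRepresentations`.** If the Boolean/commutator presentation
of `n` commuting idempotents is POLYNOMIALLY rank-stable — eventually in `n`, every matrix tuple under which all
axioms have rank `≤ t` is coordinatewise within rank `n^a · t` of a tuple of pairwise commuting idempotents —
then no CNF family witnesses the item: at the commuting tuple the clause product vanishes
(`eval_clauseProduct_eq_zero_of_commute`) and moving back costs rank `≤ size(φ_n) · n^a · t ≤ n^{e+a} · t`
(`rank_eval_clauseProduct_le_size_mul`), contradicting `rank > n^c · t` at `c = e + a`. The hypothesis with
modulus `2^{O(n)} · t` in place of `n^a · t` is known [arXiv:2401.04676, Thm 5.1]; the polynomial modulus is the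
open alternative "ST-poly" of the item's why-it-might-fail. [folklore] -/
theorem not_rankDefectRepresentations_of_polyStable
    (hST : ∃ a : ℕ, ∀ᶠ n : ℕ in atTop, ∀ (K : Type) [Field K] [CharZero K] (d t : ℕ)
      (M : Fin n → Matrix (Fin d) (Fin d) K),
      (∀ g : MonoidAlgebra K (FreeMonoid (Fin n)), IsAxiom g →
        (MonoidAlgebra.lift K (Matrix (Fin d) (Fin d) K) (FreeMonoid (Fin n)) (FreeMonoid.lift M) g).rank ≤ t) →
      ∃ M' : Fin n → Matrix (Fin d) (Fin d) K, (∀ i, M' i * M' i = M' i) ∧ (∀ i j, M' i * M' j = M' j * M' i) ∧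
        ∀ i, (M i - M' i).rank ≤ n ^ a * t) :
    ¬ Summit.PneNP.PneNP.Theses.CnfIdealGenLength.RankDefectRepresentations := by
  rintro ⟨p, φ, hφ, h⟩
  obtain ⟨a, ha⟩ := hST
  obtain ⟨e, -, he⟩ := exists_pow_bound p
  obtain ⟨n, hn, hST', K, _, _, d, t, M, hax, hrank⟩ :=
    ((eventually_ge_atTop 2).and (ha.and (h (e + a)))).exists
  obtain ⟨M', hidem, hcomm, hdist⟩ := hST' K d t M hax
  have hle := rank_eval_clauseProduct_le_size_mul M M' hidem hcomm (hφ n).1 hdist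
  have hsz : (φ n).size * (n ^ a * t) ≤ n ^ (e + a) * t := by
    calc (φ n).size * (n ^ a * t) ≤ n ^ e * (n ^ a * t) :=
          Nat.mul_le_mul_right _ ((hφ n).2.2.trans (he n hn))
      _ = n ^ (e + a) * t := by rw [pow_add, mul_assoc]
  omega

end Summit.PneNP.PneNP.Theorems.CnfIdealGenLength
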